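import Summits.Ventures.PercRepro.Induction
import Summits.Ventures.PercRepro.ConditionalSums
import Summits.Ventures.PercRepro.SMCPrinciple

/-!
# The antipodal principle: nonnegativity of quadratic forms by sub-cube induction

For a kernel `F : Config E → Config E → ℝ` let `Q(p) = Σ_{ω,ω'} w_p(ω) w_p(ω') F ω ω'`
(`dsum (weight p) (weight p) F`).  The single-merge concavity principle
(`Summits.Ventures.PercRepro.SMCPrinciple`) proves `Q ≥ 0` from a pointwise second-difference
condition.  Here is a different sufficient condition, the **antipodal criterion**: for every edge
set `S` and every configuration `ω₀` of the other edges,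
`Σ_{σ ∈ {0,1}^S} F(ω₀[S := σ], ω₀[S := σ̄]) ≥ 0` — over every sub-cube of configurations the
kernel summed over **antipodal** pairs is nonnegative.

The proof is an induction on the number of edges with `p e ∉ {0, 1}` outside `S`, using the
**corner laws** `p[S := σ]` (edges of `S` forced to the states of `σ`) and the exact identity
(`antipodalSum_update`, `g ∉ S`, `t = p g`)
`Φ_S(p) = t² Φ_S(p[g:=1]) + (1-t)² Φ_S(p[g:=0]) + 2 t(1-t) Φ_{S ∪ {g}}(p)`,
where `Φ_S(p) = Σ_σ B(π^σ, π^{σ̄})` is the bilinear form summed over antipodal corner laws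
(`antipodalSum`).  With no free edge outside `S` the corner laws are point masses and `Φ_S` is
the antipodal sum of the criterion; `Φ_∅ = 2^{|E|} Q`.

Unlike the SMC principle, the antipodal principle does not require concavity of `Q` in each edge
probability: it asks only that the **cross term** `M = Φ_{{g}}` be nonnegative, and proves that
by the same induction one level down.
-/

namespace PercRepro

open Finset

section Antipodal

variable {E : Type*} [Fintype E] [DecidableEq E]

/-- The edge probabilities `p` with the edges of `S` forced to the states of `σ`. -/
def forceOn (p : E → ℝ) (S : Finset E) (σ : Config E) : E → ℝ :=
  fun e => if e ∈ S then (if σ e then 1 else 0) else p e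

/-- The configuration `ω₀` with the edges of `S` set to the states of `σ`. -/
def patch (S : Finset E) (σ ω₀ : Config E) : Config E :=
  fun e => if e ∈ S then σ e else ω₀ e

/-- The antipode of `σ` relative to `S`: the edges of `S` are flipped. -/
def flipOn (S : Finset E) (σ : Config E) : Config E :=
  fun e => if e ∈ S then !σ e else σ e

/-- `Φ_S(p) = Σ_σ Σ_{ω,ω'} w_{p[S:=σ]}(ω) w_{p[S:=σ̄]}(ω') F ω ω'`, the bilinear form of `F`
summed over antipodal pairs of corner laws (each antipodal class appears `2^{|E∖S|}` times). -/
noncomputable def antipodalSum (p : E → ℝ) (S : Finset E) (F : Config E → Config E → ℝ) : ℝ :=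
  ∑ σ : Config E, dsum (weight (forceOn p S σ)) (weight (forceOn p S (flipOn S σ))) F

omit [Fintype E] in
/-- Outside `S` the forced weight vector agrees with `p`. -/
theorem forceOn_apply_of_notMem (p : E → ℝ) {S : Finset E} (σ : Config E) {e : E} (he : e ∉ S) :
    forceOn p S σ e = p e := by
  simp [forceOn, he]

omit [Fintype E] in
/-- Forcing `S` commutes with updating an edge outside `S`. -/
theorem forceOn_update (p : E → ℝ) {S : Finset E} {g : E} (hg : g ∉ S) (x : ℝ) (σ : Config E) :
    forceOn (Function.update p g x) S σ = Function.update (forceOn p S σ) g x := by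
  funext e
  by_cases he : e = g
  · subst he
    simp [forceOn, hg]
  · simp [forceOn, Function.update_of_ne he]

omit [Fintype E] in
/-- Forcing `insert g S` is forcing `S` and then updating `g`. -/
theorem forceOn_insert (p : E → ℝ) {S : Finset E} {g : E} (hg : g ∉ S) (σ : Config E) :
    forceOn p (insert g S) σ = Function.update (forceOn p S σ) g (if σ g then 1 else 0) := by
  funext e
  by_cases he : e = g
  · subst he
    simp [forceOn, hg]
  · simp [forceOn, he]

omit [Fintype E] in
/-- Flipping on `insert g S` is flipping on `S` followed by a flip at `g`. -/
theorem flipOn_insert {S : Finset E} {g : E} (σ : Config E) :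
    flipOn (insert g S) σ = Function.update (flipOn S σ) g (!σ g) := by
  funext e
  by_cases he : e = g
  · subst he
    simp [flipOn]
  · simp [flipOn, he]

omit [Fintype E] in
/-- Forcing `S` does not see the state of an edge outside `S`. -/
theorem forceOn_update_config (p : E → ℝ) {S : Finset E} {g : E} (hg : g ∉ S) (σ : Config E)
    (b : Bool) : forceOn p S (Function.update σ g b) = forceOn p S σ := by
  funext e
  by_cases he : e = g
  · subst he
    simp [forceOn, hg]
  · simp [forceOn, Function.update_of_ne he]

omit [Fintype E] in
/-- Flipping on `S` commutes with updating a coordinate outside `S`. -/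
theorem flipOn_update {S : Finset E} {g : E} (hg : g ∉ S) (σ : Config E) (b : Bool) :
    flipOn S (Function.update σ g b) = Function.update (flipOn S σ) g b := by
  funext e
  by_cases he : e = g
  · subst he
    simp [flipOn, hg]
  · simp [flipOn, Function.update_of_ne he]

/-- Bilinear one-edge split of `dsum` for two weight vectors. -/
theorem dsum_weight_split_two (p q : E → ℝ) (e : E) (F : Config E → Config E → ℝ) :
    dsum (weight p) (weight q) F =
      p e * q e * dsum (weight (Function.update p e 1)) (weight (Function.update q e 1)) F +
        p e * (1 - q e) * dsum (weight (Function.update p e 1)) (weight (Function.update q e 0)) F +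
        (1 - p e) * q e * dsum (weight (Function.update p e 0)) (weight (Function.update q e 1)) F +
        (1 - p e) * (1 - q e) *
          dsum (weight (Function.update p e 0)) (weight (Function.update q e 0)) F := by
  have hp : weight p = fun ω => p e * weight (Function.update p e 1) ω +
      (1 - p e) * weight (Function.update p e 0) ω := funext (weight_split p e)
  have hq : weight q = fun ω => q e * weight (Function.update q e 1) ω +
      (1 - q e) * weight (Function.update q e 0) ω := funext (weight_split q e)
  rw [hp, hq]
  unfold dsum
  simp only [Finset.mul_sum, ← Finset.sum_add_distrib]
  refine Finset.sum_congr rfl fun ω _ => Finset.sum_congr rfl fun ω' _ => ?_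
  ring

/-- For a function invariant under flipping `g`, the sums over the configurations with `g` open
and with `g` closed agree. -/
theorem sum_ite_flip_invariant (g : E) (f : Config E → ℝ)
    (hf : ∀ σ, f (flipEdge g σ) = f σ) :
    ∑ σ, (if σ g then f σ else 0) = ∑ σ, (if σ g then (0 : ℝ) else f σ) := by
  rw [← (flipEdge_involutive g).bijective.sum_comp]
  refine Finset.sum_congr rfl fun σ _ => ?_
  rw [hf σ, flipEdge_apply_self]
  cases σ g <;> simp

/-- A sum over configurations of a function invariant under flipping `g` is twice the sum over
the configurations with `g` open. -/
theorem sum_eq_two_mul_sum_of_flip_invariant (g : E) (f : Config E → ℝ)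
    (hf : ∀ σ, f (flipEdge g σ) = f σ) :
    ∑ σ, f σ = 2 * ∑ σ, (if σ g then f σ else 0) := by
  have h2 : ∑ σ, f σ = ∑ σ, (if σ g then f σ else 0) + ∑ σ, (if σ g then (0 : ℝ) else f σ) := by
    rw [← Finset.sum_add_distrib]
    refine Finset.sum_congr rfl fun σ _ => ?_
    cases σ g <;> simp
  rw [h2, ← sum_ite_flip_invariant g f hf]
  ring

/-- The same with the roles of open and closed exchanged. -/
theorem sum_eq_two_mul_sum_of_flip_invariant' (g : E) (f : Config E → ℝ)
    (hf : ∀ σ, f (flipEdge g σ) = f σ) :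
    ∑ σ, f σ = 2 * ∑ σ, (if σ g then (0 : ℝ) else f σ) := by
  rw [sum_eq_two_mul_sum_of_flip_invariant g f hf, sum_ite_flip_invariant g f hf]

/-- **The antipodal recursion**: for `g ∉ S` and `t = p g`,
`Φ_S(p) = t² Φ_S(p[g:=1]) + (1-t)² Φ_S(p[g:=0]) + 2 t (1-t) Φ_{S ∪ {g}}(p)`. -/
theorem antipodalSum_update (p : E → ℝ) {S : Finset E} {g : E} (hg : g ∉ S)
    (F : Config E → Config E → ℝ) :
    antipodalSum p S F =
      p g * p g * antipodalSum (Function.update p g 1) S F +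
        (1 - p g) * (1 - p g) * antipodalSum (Function.update p g 0) S F +
        p g * (1 - p g) * (2 * antipodalSum p (insert g S) F) := by
  -- the cross term, as a sum over all σ
  have hcross : antipodalSum p (insert g S) F =
      ∑ σ : Config E, (if σ g then
        dsum (weight (Function.update (forceOn p S σ) g 1))
          (weight (Function.update (forceOn p S (flipOn S σ)) g 0)) F
      else
        dsum (weight (Function.update (forceOn p S σ) g 0))
          (weight (Function.update (forceOn p S (flipOn S σ)) g 1)) F) := by
    unfold antipodalSum
    refine Finset.sum_congr rfl fun σ _ => ?_
    rw [forceOn_insert p hg, forceOn_insert p hg, flipOn_insert, forceOn_update_config p hg,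
      Function.update_self]
    cases h : σ g <;> simp
  have hcross2 : ∑ σ : Config E,
      (dsum (weight (Function.update (forceOn p S σ) g 1))
          (weight (Function.update (forceOn p S (flipOn S σ)) g 0)) F +
        dsum (weight (Function.update (forceOn p S σ) g 0))
          (weight (Function.update (forceOn p S (flipOn S σ)) g 1)) F) =
      2 * antipodalSum p (insert g S) F := by
    rw [hcross, Finset.sum_add_distrib]
    have hinvA : ∀ σ, (fun σ => dsum (weight (Function.update (forceOn p S σ) g 1))
        (weight (Function.update (forceOn p S (flipOn S σ)) g 0)) F) (flipEdge g σ) =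
        (fun σ => dsum (weight (Function.update (forceOn p S σ) g 1))
        (weight (Function.update (forceOn p S (flipOn S σ)) g 0)) F) σ := by
      intro σ
      simp only [flipEdge, forceOn_update_config p hg, flipOn_update hg]
    have hinvB : ∀ σ, (fun σ => dsum (weight (Function.update (forceOn p S σ) g 0))
        (weight (Function.update (forceOn p S (flipOn S σ)) g 1)) F) (flipEdge g σ) =
        (fun σ => dsum (weight (Function.update (forceOn p S σ) g 0))
        (weight (Function.update (forceOn p S (flipOn S σ)) g 1)) F) σ := by
      intro σ
      simp only [flipEdge, forceOn_update_config p hg, flipOn_update hg]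
    rw [sum_eq_two_mul_sum_of_flip_invariant g (fun σ => dsum (weight (Function.update (forceOn p S σ) g 1))
        (weight (Function.update (forceOn p S (flipOn S σ)) g 0)) F) hinvA,
      sum_eq_two_mul_sum_of_flip_invariant' g (fun σ => dsum (weight (Function.update (forceOn p S σ) g 0))
        (weight (Function.update (forceOn p S (flipOn S σ)) g 1)) F) hinvB,
      ← mul_add, ← Finset.sum_add_distrib]
    refine congrArg (2 * ·) (Finset.sum_congr rfl fun σ _ => ?_)
    cases σ g <;> simp
  -- expand Φ_S(p) with the two-vector split at g
  have hexp : antipodalSum p S F = ∑ σ : Config E,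
      (p g * p g * dsum (weight (Function.update (forceOn p S σ) g 1))
          (weight (Function.update (forceOn p S (flipOn S σ)) g 1)) F +
        p g * (1 - p g) * dsum (weight (Function.update (forceOn p S σ) g 1))
          (weight (Function.update (forceOn p S (flipOn S σ)) g 0)) F +
        (1 - p g) * p g * dsum (weight (Function.update (forceOn p S σ) g 0))
          (weight (Function.update (forceOn p S (flipOn S σ)) g 1)) F +
        (1 - p g) * (1 - p g) * dsum (weight (Function.update (forceOn p S σ) g 0))
          (weight (Function.update (forceOn p S (flipOn S σ)) g 0)) F) := by
    unfold antipodalSum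
    refine Finset.sum_congr rfl fun σ _ => ?_
    have := dsum_weight_split_two (forceOn p S σ) (forceOn p S (flipOn S σ)) g F
    rwa [forceOn_apply_of_notMem p σ hg, forceOn_apply_of_notMem p (flipOn S σ) hg] at this
  have h1 : antipodalSum (Function.update p g 1) S F = ∑ σ : Config E,
      dsum (weight (Function.update (forceOn p S σ) g 1))
        (weight (Function.update (forceOn p S (flipOn S σ)) g 1)) F := by
    unfold antipodalSum
    simp only [forceOn_update p hg]
  have h0 : antipodalSum (Function.update p g 0) S F = ∑ σ : Config E,
      dsum (weight (Function.update (forceOn p S σ) g 0))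
        (weight (Function.update (forceOn p S (flipOn S σ)) g 0)) F := by
    unfold antipodalSum
    simp only [forceOn_update p hg]
  rw [hexp, h1, h0, ← hcross2]
  simp only [Finset.mul_sum, ← Finset.sum_add_distrib]
  refine Finset.sum_congr rfl fun σ _ => ?_
  ring

omit [Fintype E] in
/-- With every edge outside `S` deterministic, forcing `S` gives a point mass. -/
theorem forceOn_eq_detWeights {p : E → ℝ} {S : Finset E}
    (hdet : ∀ e ∉ S, p e = 0 ∨ p e = 1) (σ : Config E) :
    forceOn p S σ = detWeights (patch S σ (fun e => decide (p e = 1))) := by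
  funext e
  by_cases he : e ∈ S
  · simp [forceOn, detWeights, patch, he]
  · rcases hdet e he with h | h <;> simp [forceOn, detWeights, patch, he, h]

/-- The double sum of two point masses is the value of the kernel. -/
theorem dsum_detWeights_two (ω ω' : Config E) (F : Config E → Config E → ℝ) :
    dsum (weight (detWeights ω)) (weight (detWeights ω')) F = F ω ω' := by
  unfold dsum
  rw [Finset.sum_eq_single ω]
  · rw [Finset.sum_eq_single ω']
    · simp [weight_detWeights]
    · intro x _ hx
      simp [weight_detWeights, hx]
    · simp
  · intro x _ hx
    simp [weight_detWeights, hx]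
  · simp

/-- **Base case**: with no free edge outside `S`, `Φ_S` is the antipodal sum of the kernel over
the sub-cube `S` of the configuration `ω₀ = (p = 1)`. -/
theorem antipodalSum_eq_of_det {p : E → ℝ} {S : Finset E}
    (hdet : ∀ e ∉ S, p e = 0 ∨ p e = 1) (F : Config E → Config E → ℝ) :
    antipodalSum p S F = ∑ σ : Config E,
      F (patch S σ (fun e => decide (p e = 1))) (patch S (flipOn S σ) (fun e => decide (p e = 1))) := by
  unfold antipodalSum
  refine Finset.sum_congr rfl fun σ _ => ?_
  rw [forceOn_eq_detWeights hdet, forceOn_eq_detWeights hdet, dsum_detWeights_two]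

/-- The number of free edges outside `S`. -/
noncomputable def freeCount (p : E → ℝ) (S : Finset E) : ℕ :=
  ((univ \ S).filter fun e => p e ≠ 0 ∧ p e ≠ 1).card

omit [DecidableEq E] in
/-- Forcing a free coordinate `g ∉ S` to `0` or `1` decreases the number of free coordinates. -/
theorem freeCount_update_lt {p : E → ℝ} {S : Finset E} [DecidableEq E] {g : E} (hg : g ∉ S)
    (hfree : p g ≠ 0 ∧ p g ≠ 1) {x : ℝ} (hx : x = 0 ∨ x = 1) :
    freeCount (Function.update p g x) S < freeCount p S := by
  unfold freeCount
  apply Finset.card_lt_card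
  rw [Finset.ssubset_iff_of_subset]
  · refine ⟨g, ?_, ?_⟩
    · simp [hg, hfree]
    · simp only [Finset.mem_filter, not_and, Function.update_self]
      intro _
      rcases hx with h | h <;> simp [h]
  · intro e
    simp only [Finset.mem_filter, Finset.mem_sdiff, Finset.mem_univ, true_and, and_imp]
    intro he h0 h1
    by_cases heg : e = g
    · subst heg
      exact ⟨hg, hfree⟩
    · rw [Function.update_of_ne heg] at h0 h1
      exact ⟨he, h0, h1⟩

omit [DecidableEq E] in
/-- Adding a free coordinate `g` to `S` decreases the number of free coordinates outside `S`. -/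
theorem freeCount_insert_lt {p : E → ℝ} {S : Finset E} [DecidableEq E] {g : E} (hg : g ∉ S)
    (hfree : p g ≠ 0 ∧ p g ≠ 1) : freeCount p (insert g S) < freeCount p S := by
  unfold freeCount
  apply Finset.card_lt_card
  rw [Finset.ssubset_iff_of_subset]
  · exact ⟨g, by simp [hg, hfree], by simp⟩
  · intro e
    simp only [Finset.mem_filter, Finset.mem_sdiff, Finset.mem_univ, true_and, Finset.mem_insert,
      not_or, and_imp]
    intro _ he h0 h1
    exact ⟨he, h0, h1⟩

/-- `Φ_S(p) ≥ 0` for every `S` and every probability vector, from the antipodal criterion. -/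
theorem antipodalSum_nonneg (F : Config E → Config E → ℝ)
    (hbase : ∀ (S : Finset E) (ω₀ : Config E),
      0 ≤ ∑ σ : Config E, F (patch S σ ω₀) (patch S (flipOn S σ) ω₀))
    (S : Finset E) {p : E → ℝ} (hp : IsProb p) : 0 ≤ antipodalSum p S F := by
  suffices key : ∀ n : ℕ, ∀ (S : Finset E) (p : E → ℝ), IsProb p → freeCount p S ≤ n →
      0 ≤ antipodalSum p S F from key _ S p hp le_rfl
  intro n
  induction n with
  | zero =>
    intro S p hp hn
    have hdet : ∀ e ∉ S, p e = 0 ∨ p e = 1 := by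
      intro e he
      by_contra hcon
      push Not at hcon
      have hmem : e ∈ (univ \ S).filter fun e => p e ≠ 0 ∧ p e ≠ 1 := by simp [he, hcon]
      have : 0 < freeCount p S := Finset.card_pos.2 ⟨e, hmem⟩
      omega
    rw [antipodalSum_eq_of_det hdet]
    exact hbase S _
  | succ n ih =>
    intro S p hp hn
    by_cases hfree : ∃ g, g ∉ S ∧ p g ≠ 0 ∧ p g ≠ 1
    · obtain ⟨g, hg, hg'⟩ := hfree
      have ht := hp g
      have h1 := ih S (Function.update p g 1) (hp.update g (by norm_num)) (by
        have := freeCount_update_lt hg hg' (x := 1) (Or.inr rfl)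
        omega)
      have h0 := ih S (Function.update p g 0) (hp.update g (by norm_num)) (by
        have := freeCount_update_lt hg hg' (x := 0) (Or.inl rfl)
        omega)
      have hS := ih (insert g S) p hp (by
        have := freeCount_insert_lt hg hg'
        omega)
      rw [antipodalSum_update p hg F]
      have hq : 0 ≤ p g * (1 - p g) := mul_nonneg ht.1 (sub_nonneg.2 ht.2)
      nlinarith [mul_nonneg (mul_nonneg ht.1 ht.1) h1,
        mul_nonneg (mul_nonneg (sub_nonneg.2 ht.2) (sub_nonneg.2 ht.2)) h0, mul_nonneg hq hS]
    · push Not at hfree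
      have hdet : ∀ e ∉ S, p e = 0 ∨ p e = 1 := by
        intro e he
        by_contra hcon
        push Not at hcon
        exact hcon.2 (hfree e he hcon.1)
      rw [antipodalSum_eq_of_det hdet]
      exact hbase S _

/-- `Φ_∅(p) = 2^{|E|} · Q(p)`. -/
theorem antipodalSum_empty (p : E → ℝ) (F : Config E → Config E → ℝ) :
    antipodalSum p ∅ F = (Fintype.card (Config E) : ℝ) * dsum (weight p) (weight p) F := by
  unfold antipodalSum
  have h : ∀ σ : Config E, forceOn p ∅ σ = p := fun σ => by funext e; simp [forceOn]
  simp only [h, Finset.sum_const, Finset.card_univ, nsmul_eq_mul]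

/-- **The antipodal principle**: if over every sub-cube `S` of configurations (the other edges
fixed to `ω₀`) the kernel summed over antipodal pairs is nonnegative, then the quadratic form
`Σ_{ω,ω'} w_p(ω) w_p(ω') F ω ω'` is nonnegative for every probability vector `p`. -/
theorem antipodal_principle (F : Config E → Config E → ℝ)
    (hbase : ∀ (S : Finset E) (ω₀ : Config E),
      0 ≤ ∑ σ : Config E, F (patch S σ ω₀) (patch S (flipOn S σ) ω₀))
    {p : E → ℝ} (hp : IsProb p) : 0 ≤ dsum (weight p) (weight p) F := by
  have h := antipodalSum_nonneg F hbase ∅ hp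
  rw [antipodalSum_empty] at h
  have hc : (0 : ℝ) < Fintype.card (Config E) := by
    exact_mod_cast Fintype.card_pos
  exact (mul_nonneg_iff_of_pos_left hc).1 h

end Antipodal

/-! ### The antipodal principle for the law of the marked partition -/

namespace MultiGraph

variable {V E : Type*} (G : MultiGraph V E) [Fintype E] [DecidableEq E]

/-- **Antipodal principle for marked partitions**: if for every sub-cube of edge states (the
other edges fixed) the kernel `A` summed over antipodal pairs of the resulting marked partitions
is nonnegative, then `Q_A ≥ 0` at the law of the marked partition for every `p ∈ [0,1]^E`. -/
theorem quadForm_nonneg_of_antipodal {k : ℕ} (m : Fin k → V)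
    (A : Setoid (Fin k) → Setoid (Fin k) → ℝ)
    (hbase : ∀ (S : Finset E) (ω₀ : Config E),
      0 ≤ ∑ σ : Config E, A (G.markedPartition (patch S σ ω₀) m)
        (G.markedPartition (patch S (flipOn S σ) ω₀) m))
    {p : E → ℝ} (hp : IsProb p) : 0 ≤ G.quadForm p m A := by
  rw [quadForm_eq_dsum]
  exact antipodal_principle _ hbase hp

end MultiGraph

end PercRepro
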